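import Mathlib
import Literature.MathematicalPhysics.QuantumLattice.BallSpecificationProperKernels
import HarnessLib

/-!
# `BallSpecification.BallSpecifiedFieldLimit` — stub `stub_properGermKernels` (item stmt-CriticalPhenomena-11247), proved

THEOREM-ONLY file. Registered stub `stub_properGermKernels` of the line `registered`
(`Cruxes/BallSpecifiedFieldLimit/Lines/birth.lean`): the Ising-free KERNEL-VERSION LEMMA on
`𝓢'(ℝ³)` — a probability law on `FieldConfig ℝ³` whose conditional probabilities of the interior events
of every ball given the exterior events admit germ-measurable versions admits ball kernels `γ c r η`
with conjuncts C13–C17 of the crux (probability kernels; `extEvents (closedBall c r)ᶜ`-measurable in the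
datum on every Borel event; EXACTLY `germEvents c r`-measurable on interior events; proper for EVERY
datum; DLR, `IsGibbsFor γ μ univ`).

Proof: ball by ball this is the Literature theorem
`Literature.MathematicalPhysics.QuantumLattice.exists_properGermKernel`
(`Literature/MathematicalPhysics/QuantumLattice/BallSpecificationProperKernels.lean`: regular conditional
probabilities on the standard Borel space `𝓢'(E)` — `FieldConfigStandardBorel.lean` — countable generation
of the interior events, the `0`–`1` law on exterior events, and gluing on the exceptional null set by the
measurable kill-inside extension selector of `FieldConfigKillInsideSelector.lean`); the kernels are then
chosen for all `(c, r)` with `0 < r` at once (`choose!`; for `r ≤ 0` nothing is demanded).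
-/

noncomputable section

namespace Summit.CriticalPhenomena.Ising3DConformalLimit.Theorems

open MeasureTheory Literature.MathematicalPhysics.QuantumLattice

/-- **Registered stub `stub_properGermKernels` (S3 · kernel-version lemma), proved**: a probability law on
`FieldConfig ℝ³` that is one-sided germ-Markov across every sphere in the a.e. sense (every interior event
has a `germEvents c r`-measurable version of its conditional probability given `extEvents (closedBall c r)ᶜ`)
admits ball kernels `γ` with conjuncts C13–C17 of the crux `BallSpecifiedFieldLimit`: probability kernels,
exterior-measurable in the datum on every Borel event, EXACTLY germ-measurable on interior events, proper
for EVERY datum, and DLR for `μ` on all balls (`IsGibbsFor γ μ univ`). Ball by ball this is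
`Literature.MathematicalPhysics.QuantumLattice.exists_properGermKernel`. [folklore] -/
theorem stub_properGermKernels :
    ∀ (μ : MeasureTheory.Measure (Literature.MathematicalPhysics.QuantumLattice.FieldConfig (EuclideanSpace ℝ (Fin 3)))),
      MeasureTheory.IsProbabilityMeasure μ →
      (∀ (c : EuclideanSpace ℝ (Fin 3)) (r : ℝ), 0 < r →
        ∀ A : Set (Literature.MathematicalPhysics.QuantumLattice.FieldConfig (EuclideanSpace ℝ (Fin 3))),
          MeasurableSet[Literature.MathematicalPhysics.QuantumLattice.extEvents (Metric.ball c r)] A →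
          ∃ g : Literature.MathematicalPhysics.QuantumLattice.FieldConfig (EuclideanSpace ℝ (Fin 3)) → ENNReal,
            Measurable[Literature.MathematicalPhysics.QuantumLattice.germEvents c r] g ∧
            ∀ B : Set (Literature.MathematicalPhysics.QuantumLattice.FieldConfig (EuclideanSpace ℝ (Fin 3))),
              MeasurableSet[Literature.MathematicalPhysics.QuantumLattice.extEvents (Metric.closedBall c r)ᶜ] B →
              μ (A ∩ B) = ∫⁻ η in B, g η ∂μ) →
      ∃ γ : EuclideanSpace ℝ (Fin 3) → ℝ → Literature.MathematicalPhysics.QuantumLattice.FieldConfig (EuclideanSpace ℝ (Fin 3)) → MeasureTheory.Measure (Literature.MathematicalPhysics.QuantumLattice.FieldConfig (EuclideanSpace ℝ (Fin 3))),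
        (∀ c r, 0 < r → ∀ η, MeasureTheory.IsProbabilityMeasure (γ c r η)) ∧
        (∀ c r, 0 < r → ∀ A, MeasurableSet A → Measurable[Literature.MathematicalPhysics.QuantumLattice.extEvents (Metric.closedBall c r)ᶜ] (fun η => γ c r η A)) ∧
        (∀ c r, 0 < r → ∀ A, MeasurableSet[Literature.MathematicalPhysics.QuantumLattice.extEvents (Metric.ball c r)] A → Measurable[Literature.MathematicalPhysics.QuantumLattice.germEvents c r] (fun η => γ c r η A)) ∧
        (∀ c r, 0 < r → ∀ η, ∀ᵐ ω ∂(γ c r η), ∀ f : SchwartzMap (EuclideanSpace ℝ (Fin 3)) ℝ, tsupport (f : EuclideanSpace ℝ (Fin 3) → ℝ) ⊆ (Metric.closedBall c r)ᶜ → ω f = η f) ∧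
        Literature.MathematicalPhysics.QuantumLattice.IsGibbsFor γ μ Set.univ := by
  intro μ hμ hM
  haveI := hμ
  have hmain : ∀ (c : EuclideanSpace ℝ (Fin 3)) (r : ℝ), 0 < r →
      ∃ Γ : FieldConfig (EuclideanSpace ℝ (Fin 3)) → Measure (FieldConfig (EuclideanSpace ℝ (Fin 3))),
        (∀ η, IsProbabilityMeasure (Γ η)) ∧
        (∀ A, MeasurableSet A → Measurable[extEvents (Metric.closedBall c r)ᶜ] fun η => Γ η A) ∧
        (∀ A, MeasurableSet[extEvents (Metric.ball c r)] A →
          Measurable[germEvents c r] fun η => Γ η A) ∧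
        (∀ η, ∀ᵐ ω ∂Γ η, ∀ f : SchwartzMap (EuclideanSpace ℝ (Fin 3)) ℝ,
          tsupport (f : EuclideanSpace ℝ (Fin 3) → ℝ) ⊆ (Metric.closedBall c r)ᶜ → ω f = η f) ∧
        ∀ A, MeasurableSet A → ∀ B, MeasurableSet[extEvents (Metric.closedBall c r)ᶜ] B →
          μ (A ∩ B) = ∫⁻ η in B, Γ η A ∂μ :=
    fun c r hr => exists_properGermKernel μ c r (hM c r hr)
  choose! Γ hΓ using hmain
  refine ⟨Γ, fun c r hr => (hΓ c r hr).1, fun c r hr => (hΓ c r hr).2.1,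
    fun c r hr => (hΓ c r hr).2.2.1, fun c r hr => (hΓ c r hr).2.2.2.1, ⟨hμ, ?_⟩⟩
  intro c r hr _ A hA B hB
  exact (hΓ c r hr).2.2.2.2 A hA B hB

end Summit.CriticalPhenomena.Ising3DConformalLimit.Theorems

end
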